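import Mathlib
import Literature.AlgebraicGeometry.Tropical.InitialIdeal

/-!
# TropicalLinks / InductiveStep — weights below the graph are off the tropical variety

Route `ResolutionOfSingularities/TropicalLinks`, crux `InductiveStep` (stmt-ResolutionOfSingularities-17233),
line `split`, in support of stub `stub_sncClosureSchon`.

For the unit-graph re-embedding `I' = ⟨ι(I), y_j − ι(G_j)⟩ ⊆ k[ℤ^(N+m)]` of the route and an integer
weight `w = (w', w'') ∈ ℤ^N × ℤ^m`: if for some `j` the weight `w''_j` of the new variable `y_j` is
STRICTLY SMALLER than the `w'`-weight of every monomial of `G_j`, then the initial form of the generator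
`y_j − ι(G_j)` is the unit `y_j` alone, so the initial ideal `in_w(I')` is the whole ring and the
degeneration `k[ℤ^(N+m)] ⧸ in_w(I')` is EMPTY — the schön clause of `SchonAt` holds vacuously at such
weights (they lie off the tropical variety of `U[G⁻¹]`, which is the graph of `trop(G)` over `Trop U`).

* `tropicalLinks_weightInitialIdeal_eq_span` — the tree's `weightInitialIdeal w J` is the route's inlined
  `Ideal.span (in_w '' J)` for ANY decidability instances hidden in `Finsupp.filter` (bridge; the
  route's term carries the classical instance);
* `tropicalLinks_inIdeal_eq_top_of_weight_lt` — the statement above, in the route's inlined terms;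
* `tropicalLinks_schonClause_of_weight_lt` — the vacuous schön clause at such weights.
-/

-- single-problem summit: the doubled namespace component `ResolutionOfSingularities` is forced
set_option linter.dupNamespace false

namespace Summit.ResolutionOfSingularities.ResolutionOfSingularities.Theorems

open AddMonoidAlgebra Literature.AlgebraicGeometry.Tropical

/-- **Bridge to the definition file**: `weightInitialIdeal w J` IS the route's inlined initial ideal
`Ideal.span (in_w '' J)`, for any family `dec` of decidability instances inside `Finsupp.filter`
(propositionally, by subsingleton elimination; cf. the crux's Disproof.lean, trap T1). [folklore] -/
theorem tropicalLinks_weightInitialIdeal_eq_span {k : Type} [Field k] {M : ℕ} (w : Fin M → ℤ)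
    (J : Ideal (AddMonoidAlgebra k (Fin M → ℤ)))
    (dec : ∀ f : AddMonoidAlgebra k (Fin M → ℤ),
      DecidablePred fun v : Fin M → ℤ => ∀ u ∈ f.coeff.support, ∑ i, w i * v i ≤ ∑ i, w i * u i) :
    weightInitialIdeal w J =
      Ideal.span ((fun f : AddMonoidAlgebra k (Fin M → ℤ) => AddMonoidAlgebra.ofCoeff
        (@Finsupp.filter (Fin M → ℤ) k _ (fun v => ∀ u ∈ f.coeff.support, ∑ i, w i * v i ≤ ∑ i, w i * u i)
          (dec f) f.coeff)) '' (↑J : Set (AddMonoidAlgebra k (Fin M → ℤ)))) := by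
  unfold weightInitialIdeal initialIdeal initialForm dotWeight
  congr! 5

/-- **The initial form of `y_j − ι(G_j)` is `y_j` when `y_j` is strictly lightest.** In `k[ℤ^(N+m)]`,
let `e = (0, e_j)` and `g = ι(G_j)` (exponents `(u, 0)`, `u ∈ supp G_j`); if `⟨w, e⟩ < ⟨w, (u,0)⟩` for
every `u ∈ supp G_j` then `in_w(x^e − g) = x^e`. [folklore] -/
theorem tropicalLinks_initialForm_single_sub_eq {k : Type} [Field k] {N m : ℕ} (w : Fin (N + m) → ℤ)
    (Gj : AddMonoidAlgebra k (Fin N → ℤ)) (j : Fin m)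
    (hlt : ∀ u ∈ Gj.coeff.support, w (Fin.natAdd N j) < ∑ i, w (Fin.castAdd m i) * u i) :
    initialForm (dotWeight w)
        (single (Fin.append (0 : Fin N → ℤ) (Pi.single j (1 : ℤ))) (1 : k) -
          AddMonoidAlgebra.ofCoeff (Gj.coeff.mapDomain fun v => Fin.append v (0 : Fin m → ℤ))) =
      single (Fin.append (0 : Fin N → ℤ) (Pi.single j (1 : ℤ))) 1 := by
  classical
  -- notation
  generalize he : Fin.append (0 : Fin N → ℤ) (Pi.single j (1 : ℤ)) = e
  have he_apply : e (Fin.natAdd N j) = 1 := by rw [← he, Fin.append_right, Pi.single_eq_same]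
  have hwe : dotWeight w e = w (Fin.natAdd N j) := by
    rw [← he, dotWeight_apply, Fin.sum_univ_add]
    simp [Fin.append_left, Fin.append_right, Pi.single_apply]
  have hwu : ∀ u : Fin N → ℤ, dotWeight w (Fin.append u (0 : Fin m → ℤ)) = ∑ i, w (Fin.castAdd m i) * u i := by
    intro u
    rw [dotWeight_apply, Fin.sum_univ_add]
    simp [Fin.append_left, Fin.append_right]
  have hne : ∀ u : Fin N → ℤ, Fin.append u (0 : Fin m → ℤ) ≠ e := by
    intro u h
    have h1 := congrFun h (Fin.natAdd N j)
    rw [Fin.append_right, he_apply] at h1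
    exact zero_ne_one h1
  set g : AddMonoidAlgebra k (Fin (N + m) → ℤ) :=
    AddMonoidAlgebra.ofCoeff (Gj.coeff.mapDomain fun v => Fin.append v (0 : Fin m → ℤ)) with hg
  have hg_coeff : g.coeff = Gj.coeff.mapDomain fun v => Fin.append v (0 : Fin m → ℤ) := rfl
  have hg_e : g.coeff e = 0 := by
    rw [hg_coeff]
    exact Finsupp.mapDomain_notin_range _ _ (by rintro ⟨u, hu⟩; exact hne u hu)
  have hg_supp : ∀ v ∈ g.coeff.support, ∃ u ∈ Gj.coeff.support, Fin.append u (0 : Fin m → ℤ) = v := by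
    intro v hv
    rw [hg_coeff] at hv
    simpa only [Finset.mem_image] using Finsupp.mapDomain_support hv
  -- coefficients of `f₀ = x^e − g`
  have hf_coeff : ∀ v, (single e (1 : k) - g).coeff v = (Finsupp.single e (1 : k)) v - g.coeff v := fun v => rfl
  have hf_e : (single e (1 : k) - g).coeff e = 1 := by
    rw [hf_coeff, Finsupp.single_eq_same, hg_e, sub_zero]
  have he_supp : e ∈ (single e (1 : k) - g).coeff.support := by
    rw [Finsupp.mem_support_iff, hf_e]
    exact one_ne_zero
  have hsupp : ∀ v ∈ (single e (1 : k) - g).coeff.support, v = e ∨ ∃ u ∈ Gj.coeff.support, Fin.append u (0 : Fin m → ℤ) = v := by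
    intro v hv
    have hv' : v ∈ (Finsupp.single e (1 : k) - g.coeff).support := hv
    rcases Finset.mem_union.1 (Finsupp.support_sub hv') with h | h
    · exact Or.inl (Finset.mem_singleton.1 (Finsupp.support_single_subset h))
    · exact Or.inr (hg_supp v h)
  -- compare coefficients
  apply AddMonoidAlgebra.coeff_injective
  ext v
  rw [coeff_initialForm_apply, coeff_single, Finsupp.single_apply]
  by_cases hv : e = v
  · subst hv
    rw [if_pos, if_pos rfl, hf_e]
    intro u hu
    rcases hsupp u hu with rfl | ⟨u', hu', rfl⟩
    · exact le_rfl
    · rw [hwe, hwu]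
      exact (hlt u' hu').le
  · rw [if_neg hv]
    by_cases hvs : v ∈ (single e (1 : k) - g).coeff.support
    · rw [if_neg]
      intro hall
      rcases hsupp v hvs with rfl | ⟨u', hu', rfl⟩
      · exact hv rfl
      · have h1 := hall e he_supp
        rw [hwe, hwu] at h1
        exact (not_le.2 (hlt u' hu')) h1
    · rw [Finsupp.notMem_support_iff.1 hvs]
      split <;> rfl

open scoped Classical in
/-- **Weights below the graph are off the tropical variety.** For the route's extended ideal
`I' = ⟨ι(I), y_j − ι(G_j)⟩ ⊆ k[ℤ^(N+m)]` and a weight `w ∈ ℤ^(N+m)`: if for some `j` one has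
`w_(N+j) < Σ_i w_i u_i` for every exponent `u` of `G_j`, then the route's inlined initial ideal
`in_w(I')` is the whole ring (`in_w(y_j − ι G_j) = y_j` is a unit). [folklore] -/
theorem tropicalLinks_inIdeal_eq_top_of_weight_lt :
    ∀ (k : Type) [Field k] (N m : ℕ) (I : Ideal (AddMonoidAlgebra k (Fin N → ℤ))) (G : Fin m → AddMonoidAlgebra k (Fin N → ℤ)) (w : Fin (N + m) → ℤ) (j : Fin m), (∀ u ∈ (G j).coeff.support, w (Fin.natAdd N j) < ∑ i, w (Fin.castAdd m i) * u i) → Ideal.span ((fun f : AddMonoidAlgebra k (Fin (N + m) → ℤ) => AddMonoidAlgebra.ofCoeff (f.coeff.filter fun v => ∀ u ∈ f.coeff.support, ∑ i, w i * v i ≤ ∑ i, w i * u i)) '' (↑(Ideal.span ((fun f : AddMonoidAlgebra k (Fin N → ℤ) => (AddMonoidAlgebra.ofCoeff (f.coeff.mapDomain fun v => Fin.append v (0 : Fin m → ℤ)) : AddMonoidAlgebra k (Fin (N + m) → ℤ))) '' (↑I : Set (AddMonoidAlgebra k (Fin N → ℤ))) ∪ Set.range (fun j : Fin m => AddMonoidAlgebra.single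 (Fin.append (0 : Fin N → ℤ) (Pi.single j (1 : ℤ))) (1 : k) - AddMonoidAlgebra.ofCoeff ((G j).coeff.mapDomain fun v => Fin.append v (0 : Fin m → ℤ))))) : Set (AddMonoidAlgebra k (Fin (N + m) → ℤ)))) = ⊤ := by
  intro k _ N m I G w j hlt
  generalize hT : ((fun f : AddMonoidAlgebra k (Fin N → ℤ) => (AddMonoidAlgebra.ofCoeff (f.coeff.mapDomain fun v => Fin.append v (0 : Fin m → ℤ)) : AddMonoidAlgebra k (Fin (N + m) → ℤ))) '' (↑I : Set (AddMonoidAlgebra k (Fin N → ℤ))) ∪ Set.range (fun j : Fin m => AddMonoidAlgebra.single (Fin.append (0 : Fin N → ℤ) (Pi.single j (1 : ℤ))) (1 : k) - AddMonoidAlgebra.ofCoeff ((G j).coeff.mapDomain fun v => Fin.append v (0 : Fin m → ℤ)))) = T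
  refine Eq.trans (tropicalLinks_weightInitialIdeal_eq_span w (Ideal.span T) _).symm ?_
  have hmem : single (Fin.append (0 : Fin N → ℤ) (Pi.single j (1 : ℤ))) (1 : k) -
      AddMonoidAlgebra.ofCoeff ((G j).coeff.mapDomain fun v => Fin.append v (0 : Fin m → ℤ)) ∈ Ideal.span T :=
    Ideal.subset_span (by rw [← hT]; exact Or.inr ⟨j, rfl⟩)
  have hin := initialForm_mem_initialIdeal (dotWeight w) hmem
  rw [tropicalLinks_initialForm_single_sub_eq w (G j) j hlt] at hin
  exact Ideal.eq_top_of_isUnit_mem _ hin (isUnit_single isUnit_one _)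

open scoped Classical in
/-- **The schön clause holds vacuously below the graph**: under the hypothesis of
`tropicalLinks_inIdeal_eq_top_of_weight_lt` the degeneration `k[ℤ^(N+m)] ⧸ in_w(I')` is the zero
ring, has no prime ideal, and every localization-at-a-prime statement about it holds. [folklore] -/
theorem tropicalLinks_schonClause_of_weight_lt :
    ∀ (k : Type) [Field k] (N m : ℕ) (I : Ideal (AddMonoidAlgebra k (Fin N → ℤ))) (G : Fin m → AddMonoidAlgebra k (Fin N → ℤ)) (w : Fin (N + m) → ℤ) (j : Fin m), (∀ u ∈ (G j).coeff.support, w (Fin.natAdd N j) < ∑ i, w (Fin.castAdd m i) * u i) → ∀ (P : Ideal (AddMonoidAlgebra k (Fin (N + m) → ℤ) ⧸ Ideal.span ((fun f : AddMonoidAlgebra k (Fin (N + m) → ℤ) => AddMonoidAlgebra.ofCoeff (f.coeff.filter fun v => ∀ u ∈ f.coeff.support, ∑ i, w i * v i ≤ ∑ i, w i * u i)) '' (↑(Ideal.span ((fun f : AddMonoidAlgebra k (Fin N → ℤ) => (AddMonoidAlgebra.ofCoeff (f.coeff.mapDomain fun v => Fin.append v (0 : Fin m → ℤ)) : AddMonoidAlgebra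 k (Fin (N + m) → ℤ))) '' (↑I : Set (AddMonoidAlgebra k (Fin N → ℤ))) ∪ Set.range (fun j : Fin m => AddMonoidAlgebra.single (Fin.append (0 : Fin N → ℤ) (Pi.single j (1 : ℤ))) (1 : k) - AddMonoidAlgebra.ofCoeff ((G j).coeff.mapDomain fun v => Fin.append v (0 : Fin m → ℤ))))) : Set (AddMonoidAlgebra k (Fin (N + m) → ℤ)))))) [P.IsPrime], IsRegularLocalRing (Localization.AtPrime P) := by
  intro k _ N m I G w j hlt P hP
  exfalso
  haveI := Ideal.Quotient.subsingleton_iff.mpr (tropicalLinks_inIdeal_eq_top_of_weight_lt k N m I G w j hlt)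
  exact hP.ne_top (Subsingleton.elim _ _)

end Summit.ResolutionOfSingularities.ResolutionOfSingularities.Theorems
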